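import Mathlib
import Summits.ResolutionOfSingularities.ResolutionOfSingularities.Theorems.RadicialJungCleanModelsCleanProp44PointStep
import HarnessLib

/-!
# Route `RadicialJung`, crux `CleanModels` (stmt-ResolutionOfSingularities-15917), line `Sketch` rev 35, stub 6 `stub_cleanProp44` (X44c):
# THE POINTS-ONLY CLEAN DESCENT — (R2) ⟸ (R2ˡⁱⁿᵉ) — and the SEVENTH CUT X44c ⟸ (R1) ∧ (R2ˡⁱⁿᵉ) ∧ (R3ᵛⁿ′)

Seat decomp-res-hand-2 g16 (structural hand), companion of ✓ `…CleanProp44PointStep.lean` (the clean point step without lines and the step of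
the descent `exists_next_stage_of_nearLine`) and of g15's census ✓ `cleanProp44_of_tauOneResidualVN3 : (R1) → (R2ᵛⁿ′) → (R3ᵛⁿ′) → X44c`.

* `exists_isCleanPermissibleSeq_lt_comap_of_isolated_tauOne_of_nearLine` — **THE POINTS-ONLY CLEAN DESCENT: (R2) ⟸ (R2ˡⁱⁿᵉ)**.  If the clean
  `τ = 1` isolated-point slice (R2) (`htauOne` of ✓ `cleanProp44_of_tauOneResidual`, binders verbatim) holds at every point `x` whose blowing
  up carries a NEAR LINE — a non-closed point `η'` over `x` with `ord_{η'} J₁ = m` —, then it holds at EVERY isolated `τ = 1` point.  Proof: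
  otherwise the step never meets a line (dependent choice over the stages of ✓ `exists_next_stage_of_nearLine`, packaged in an inline
  `Σ'`-type; no new definition) and its marked points form an infinite chain of `τ = 1` near closed threefold points under POINT blowing ups,
  centres coincident with `Σ_m` at the chain point because the chain point is isolated in its open — forbidden by ✓ `CP2008Prop44.stub_T1`
  ([CoP1] p. 11 over CJS 2020 Thm. 13.7).
* `cleanProp44_of_tauOneResidualLine` — **SEVENTH CUT: X44c ⟸ (R1) ∧ (R2ˡⁱⁿᵉ) ∧ (R3ᵛⁿ′)** over ✓ `cleanProp44_of_tauOneResidualVN3`.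

NET for the planner: the point part of the `τ = 1` residual of stub 6 is, BY NAME, the near LINES over `τ = 1` points (the births world of memo
4e §2.4–2.6: a near line of `Σ_m` must be blown up and that curve blowing up must be clean-permissible); chains of very near POINTS cost nothing
beyond the landed T1.  RE-LINE proposal: `stub_cleanProp44 := cleanProp44_of_tauOneResidualLine stub_cleanPhaseTwo stub_cleanTauOnePointLine
stub_cleanCurveTauOneVN`.

Honest framing: OURS; (R1), (R2ˡⁱⁿᵉ), (R3ᵛⁿ′) are NOT proved here; nothing here proves X44c, any case of `CleanModels`, or resolution of
singularities in characteristic `p`. [cite: CossartPiltant2008, Prop. 4.2 (b), Lemma 4.3, Prop. 4.4 (proof, pp. 10–11), Lemma 4.5]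
[cite: CossartJannsenSaito2020, Thm. 13.7] [cite: Piltant2013, Prop. 5.1 (proof, Step 2)]
-/

noncomputable section

set_option linter.dupNamespace false -- mandated namespace of this single-conjunct summit

open CategoryTheory CategoryTheory.Limits AlgebraicGeometry TopologicalSpace IsLocalRing
open Literature.AlgebraicGeometry.Resolution Literature.AlgebraicGeometry.Motives
open Scheme.IdealSheafData
open Summit.ResolutionOfSingularities.ResolutionOfSingularities.Theorems.CP2008Prop44

namespace Summit.ResolutionOfSingularities.ResolutionOfSingularities.Theorems.RadicialJung.CleanModels

/-! ## §1 The points-only descent: (R2) ⟸ (R2ˡⁱⁿᵉ) -/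

set_option maxHeartbeats 3200000 in
-- the chain bookkeeping (an inline `Σ'`-type of stages, no new definition) is long to elaborate
/-- **THE POINTS-ONLY CLEAN DESCENT: the clean `τ = 1` isolated-point slice (R2) holds everywhere as soon as it holds at the points whose
blowing up carries a NEAR LINE.**  Hypothesis `hline` = (R2) `htauOne` of ✓ `cleanProp44_of_tauOneResidual` (binders verbatim) with ONE MORE
binder: some blowing up `π : X₁ → X` of `X` at `x` has a NON-CLOSED point `η'` over `x` with `ord_{η'} J₁ = m` (a near line of the exceptional
plane inside `Σ_m(J₁)`).  Conclusion: (R2) at every isolated `τ = 1` point (binders of `htauOne` verbatim).  Proof: if `(V, J|_V, m)` admits no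
clean sequence, the clean point step without lines (`exists_bad_near_point_of_forall_near_isClosed`; a line never occurs, by `hline`) runs for
ever and its marked points form an infinite chain of `τ = 1` near closed threefold points under POINT blowing ups — centres coincident with
`Σ_m` at the chain point because the chain point is isolated in its open — forbidden by ✓ `CP2008Prop44.stub_T1` ([CoP1] p. 11 / CJS 2020
Thm. 13.7). [cite: CossartPiltant2008, Prop. 4.4 (proof, p. 11), Lemma 4.5] [cite: CossartJannsenSaito2020, Thm. 13.7] -/
theorem exists_isCleanPermissibleSeq_lt_comap_of_isolated_tauOne_of_nearLine {p : ℕ} (hp : p.Prime) {m : ℕ} (hm : 1 ≤ m)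
    (hline : ∀ {X : Scheme.{0}} [IsIntegral X] [IsNoetherian X], CharP X.functionField p →
      ∀ (hX : Scheme.IsRegular X), Scheme.IsQuasiExcellent X → topologicalKrullDim X ≤ 3 →
      ∀ (G : X.functionField), (∀ x : X, CleanRegAt p (algebraMap (X.presheaf.stalk x) X.functionField) G) →
      ∀ (J : X.IdealSheafData), (∀ z, idealOrder J z ≤ m) → (∀ z ∈ J.support, 1 < Order.coheight z) →
      ∀ (V : X.Opens) (x : X), x ∈ V → ∀ (hcl : IsClosed ({x} : Set X)),
      (∀ z : X, (m : ℕ∞) ≤ idealOrder J z → z = x ∨ z ∉ (V : Set X)) → idealOrder J x = m →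
      (maximalIdeal (X.presheaf.stalk x)).spanFinrank = 3 → (haveI := hX x; stalkTau J x m = 1) → IsGRing (X.presheaf.stalk x) →
      -- (LINE) some blowing up of `X` at `x` carries a near line over `x`
      (∃ (X₁ : Scheme.{0}) (π : X₁ ⟶ X), IsBlowup π (vanishingIdeal ⟨{x}, hcl⟩) ∧
        ∃ η : X₁, π η = x ∧ idealOrder (controlledTransform π (vanishingIdeal ⟨{x}, hcl⟩) J m) η = m ∧ ¬ IsClosed ({η} : Set X₁)) →
      ∀ [IsIntegral ((V : X.Opens) : Scheme.{0})] [IsDominant V.ι],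
      ∃ (V' : Scheme.{0}) (π : V' ⟶ V) (_ : IsIntegral V') (_ : IsDominant π) (K' : V'.IdealSheafData),
        IsCleanPermissibleSeq p π (J.comap V.ι) m K' (RatFn.functionFieldMap V.ι G) ∧ ∀ y, idealOrder K' y < m)
    {X : Scheme.{0}} [IsIntegral X] [IsNoetherian X] [hcharX : CharP X.functionField p] (hX : Scheme.IsRegular X)
    (hqe : Scheme.IsQuasiExcellent X) (hX3 : topologicalKrullDim X ≤ 3) (G : X.functionField)
    (hG : ∀ x : X, CleanRegAt p (algebraMap (X.presheaf.stalk x) X.functionField) G)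
    (J : X.IdealSheafData) (hle : ∀ z, idealOrder J z ≤ m) (hcodim : ∀ z ∈ J.support, 1 < Order.coheight z)
    (V : X.Opens) (x : X) (hxV : x ∈ V) (hcl : IsClosed ({x} : Set X))
    (hbad : ∀ z : X, (m : ℕ∞) ≤ idealOrder J z → z = x ∨ z ∉ (V : Set X)) (hord : idealOrder J x = m)
    (hdim : (maximalIdeal (X.presheaf.stalk x)).spanFinrank = 3) (hτ : haveI := hX x; stalkTau J x m = 1)
    (hGr : IsGRing (X.presheaf.stalk x)) [IsIntegral ((V : X.Opens) : Scheme.{0})] [IsDominant V.ι] :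
    ∃ (V' : Scheme.{0}) (π : V' ⟶ V) (_ : IsIntegral V') (_ : IsDominant π) (K' : V'.IdealSheafData),
      IsCleanPermissibleSeq p π (J.comap V.ι) m K' (RatFn.functionFieldMap V.ι G) ∧ ∀ y, idealOrder K' y < m := by
  classical
  by_contra hnot
  -- the stages of the descent: `(Y, J, G, W, y)` with the standing hypotheses, `y` an isolated `τ = 1` point of the `m`-stratum of the open `W`
  -- (closed, threefold, G-ring), and NO clean sequence on `W` (an inline `Σ'`-type — the one of `exists_next_stage_of_nearLine`; no definition)
  let St : Type 1 := Σ' (Y : Scheme.{0}) (_ : IsIntegral Y) (_ : IsNoetherian Y) (JY : Y.IdealSheafData) (GY : Y.functionField)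
    (W : Y.Opens) (y : Y),
    CharP Y.functionField p ∧ Scheme.IsRegular Y ∧ Scheme.IsQuasiExcellent Y ∧ topologicalKrullDim Y ≤ 3 ∧
      (∀ z : Y, CleanRegAt p (algebraMap (Y.presheaf.stalk z) Y.functionField) GY) ∧
      (∀ z, idealOrder JY z ≤ m) ∧ (∀ z ∈ JY.support, 1 < Order.coheight z) ∧ y ∈ W ∧ IsClosed ({y} : Set Y) ∧
      (∀ z : Y, (m : ℕ∞) ≤ idealOrder JY z → z = y ∨ z ∉ (W : Set Y)) ∧ idealOrder JY y = m ∧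
      (maximalIdeal (Y.presheaf.stalk y)).spanFinrank = 3 ∧ (∀ h : IsRegularLocalRing (Y.presheaf.stalk y), @stalkTau Y JY y h m = 1) ∧
      IsGRing (Y.presheaf.stalk y) ∧
      ¬ ∀ [IsIntegral ((W : Y.Opens) : Scheme.{0})] [IsDominant W.ι],
        ∃ (V' : Scheme.{0}) (ϖ : V' ⟶ W) (_ : IsIntegral V') (_ : IsDominant ϖ) (K' : V'.IdealSheafData),
          IsCleanPermissibleSeq p ϖ (JY.comap W.ι) m K' (RatFn.functionFieldMap W.ι GY) ∧ ∀ y, idealOrder K' y < m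
  let s₀ : St := ⟨X, inferInstance, inferInstance, J, G, V, x, hcharX, hX, hqe, hX3, hG, hle, hcodim, hxV, hcl, hbad, hord, hdim,
    fun h => hτ, hGr, fun h => hnot h⟩
  -- THE STEP on bundled stages
  have hstep : ∀ s : St, ∃ (s' : St) (hc : IsClosed ({s.2.2.2.2.2.2.1} : Set s.1)) (π : s'.1 ⟶ s.1),
      IsBlowup π (vanishingIdeal ⟨{s.2.2.2.2.2.2.1}, hc⟩) ∧ π s'.2.2.2.2.2.2.1 = s.2.2.2.2.2.2.1 ∧
        s'.2.2.2.1 = controlledTransform π (vanishingIdeal ⟨{s.2.2.2.2.2.2.1}, hc⟩) s.2.2.2.1 m := fun s =>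
    exists_next_stage_of_nearLine hp hm hline s.1 s.2.1 s.2.2.1 s.2.2.2.1 s.2.2.2.2.1 s.2.2.2.2.2.1 s.2.2.2.2.2.2.1 s.2.2.2.2.2.2.2
  -- THE CHAIN: dependent choice over the stages (the sequence `f` is then made opaque)
  choose g hg using hstep
  have hseq : ∃ f : ℕ → St, ∀ n, ∃ (hc : IsClosed ({(f n).2.2.2.2.2.2.1} : Set (f n).1)) (π : (f (n + 1)).1 ⟶ (f n).1),
      IsBlowup π (vanishingIdeal ⟨{(f n).2.2.2.2.2.2.1}, hc⟩) ∧ π (f (n + 1)).2.2.2.2.2.2.1 = (f n).2.2.2.2.2.2.1 ∧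
        (f (n + 1)).2.2.2.1 = controlledTransform π (vanishingIdeal ⟨{(f n).2.2.2.2.2.2.1}, hc⟩) (f n).2.2.2.1 m :=
    ⟨fun n => Nat.rec (motive := fun _ => St) s₀ (fun _ s => g s) n, fun n => hg _⟩
  rcases hseq with ⟨f, hf⟩
  choose hgc hgπ hgblow hgpt hgJ using hf
  -- the data of ✓ `stub_T1`, made opaque (only the `G`-free fields of the stages are kept)
  have hpack : ∃ (Xs : ℕ → Scheme.{0}) (_ : ∀ n, IsIntegral (Xs n)) (_ : ∀ n, IsNoetherian (Xs n)) (Js : ∀ n, (Xs n).IdealSheafData)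
      (Ws : ∀ n, (Xs n).Opens) (pt : ∀ n, Xs n) (πs : ∀ n, Xs (n + 1) ⟶ Xs n) (_ : ∀ n, Scheme.IsRegular (Xs n))
      (_ : ∀ n z, idealOrder (Js n) z ≤ m) (_ : ∀ n, ∀ z ∈ (Js n).support, 1 < Order.coheight z) (_ : ∀ n, pt n ∈ Ws n)
      (_ : ∀ n (z : Xs n), (m : ℕ∞) ≤ idealOrder (Js n) z → z = pt n ∨ z ∉ (Ws n : Set (Xs n))) (_ : ∀ n, idealOrder (Js n) (pt n) = m)
      (_ : ∀ n, (maximalIdeal ((Xs n).presheaf.stalk (pt n))).spanFinrank = 3)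
      (_ : ∀ n, ∀ h : IsRegularLocalRing ((Xs n).presheaf.stalk (pt n)), @stalkTau (Xs n) (Js n) (pt n) h m = 1)
      (_ : ∀ n, IsGRing ((Xs n).presheaf.stalk (pt n)))
      (hptcl : ∀ n, IsClosed ({pt n} : Set (Xs n))),
        (∀ n, IsBlowup (πs n) (vanishingIdeal ⟨{pt n}, hptcl n⟩)) ∧ (∀ n, πs n (pt (n + 1)) = pt n) ∧
          (∀ n, Js (n + 1) = controlledTransform (πs n) (vanishingIdeal ⟨{pt n}, hptcl n⟩) (Js n) m) :=
    ⟨fun n => (f n).1, fun n => (f n).2.1, fun n => (f n).2.2.1, fun n => (f n).2.2.2.1,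
      fun n => (f n).2.2.2.2.2.1, fun n => (f n).2.2.2.2.2.2.1, hgπ, fun n => (f n).2.2.2.2.2.2.2.2.1,
      fun n => (f n).2.2.2.2.2.2.2.2.2.2.2.2.1, fun n => (f n).2.2.2.2.2.2.2.2.2.2.2.2.2.1, fun n => (f n).2.2.2.2.2.2.2.2.2.2.2.2.2.2.1,
      fun n => (f n).2.2.2.2.2.2.2.2.2.2.2.2.2.2.2.2.1, fun n => (f n).2.2.2.2.2.2.2.2.2.2.2.2.2.2.2.2.2.1,
      fun n => (f n).2.2.2.2.2.2.2.2.2.2.2.2.2.2.2.2.2.2.1, fun n => (f n).2.2.2.2.2.2.2.2.2.2.2.2.2.2.2.2.2.2.2.1,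
      fun n => (f n).2.2.2.2.2.2.2.2.2.2.2.2.2.2.2.2.2.2.2.2.1, hgc, hgblow, hgpt, hgJ⟩
  rcases hpack with ⟨Xs, hint, hnoeth, Js, Ws, pt, πs, hXreg, hle', hcodim', hptW, hbad', hord', hdim', hτ', hGr', hptcl, hπblow, hπpt,
    hπJ⟩
  have hN : ∀ n, IsLocallyNoetherian (Xs n) := fun n => inferInstance
  let Ys : ∀ n, Closeds (Xs n) := fun n => ⟨{pt n}, hptcl n⟩
  let ys : ∀ n, Xs (n + 1) := fun n => pt (n + 1)
  refine stub_T1 Xs hN hXreg πs Ys ys Js hm (fun n => ?_) (fun n => ?_) (fun n => ?_) (fun n => isIrreducible_singleton)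
    (fun n => CampaignW46.isRegular_subscheme_vanishingIdeal_singleton (hptcl n)) (fun n z hz => ?_) (fun n => hπblow n)
    (fun n => hπJ n) (fun n z => hle' n z) (fun n z hz => hcodim' n z hz) (fun n => ?_)
    (fun n => ?_) (fun n => ?_) (fun n => ?_) (fun n z hz hordz => ?_)
  · -- `hy`
    show πs (n + 1) (pt (n + 1 + 1)) = pt (n + 1)
    exact hπpt (n + 1)
  · -- `hmem`
    show πs n (pt (n + 1)) ∈ ({pt n} : Set (Xs n))
    rw [hπpt n]
    exact Set.mem_singleton _
  · -- `hcl`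
    show IsClosed ({πs n (pt (n + 1))} : Set (Xs n))
    rw [hπpt n]
    exact hptcl n
  · -- `hYord`
    have hz' : z = pt n := hz
    rw [hz']
    exact hord' n
  · -- `hd`
    show (maximalIdeal ((Xs n).presheaf.stalk (πs n (pt (n + 1))))).spanFinrank = 3
    rw [hπpt n]
    exact hdim' n
  · -- `hnear`
    refine isNear_iff.mpr ?_
    show idealOrder (controlledTransform (πs n) (vanishingIdeal ⟨{pt n}, hptcl n⟩) (Js n) m) (pt (n + 1)) = m
    have h : idealOrder (Js (n + 1)) (pt (n + 1)) = m := hord' (n + 1)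
    rw [hπJ n] at h
    exact h
  · -- `hτ`
    have h := hτ' n
    have key : ∀ (w : Xs n) (hw : w = pt n) (hr : IsRegularLocalRing ((Xs n).presheaf.stalk w)), @stalkTau (Xs n) (Js n) w hr m = 1 := by
      intro w hw hr
      subst hw
      exact h hr
    exact key _ (hπpt n) _
  · -- `hG`
    show IsGRing ((Xs n).presheaf.stalk (πs n (pt (n + 1))))
    rw [hπpt n]
    exact hGr' n
  · -- `hcoinc`: the chain point is isolated in its open, so every order-`m` generization of it is the point itself
    show z ∈ ({pt n} : Set (Xs n))
    have hz' : z ⤳ pt n := by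
      have e : πs n (ys n) = pt n := hπpt n
      rw [e] at hz
      exact hz
    have hzW : z ∈ (Ws n : Set (Xs n)) := hz'.mem_open (Ws n).2 (hptW n)
    rcases hbad' n z hordz.ge with h | h
    · exact h
    · exact absurd hzW h

/-! ## §2 SEVENTH CUT: X44c ⟸ (R1) ∧ (R2ˡⁱⁿᵉ) ∧ (R3ᵛⁿ′) -/

set_option maxHeartbeats 1600000 in
-- long binder lists
/-- **THE CLEAN ASSEMBLY, SEVENTH CUT: X44c (`stub_cleanProp44`, verbatim) ⟸ (R1) ∧ (R2ˡⁱⁿᵉ) ∧ (R3ᵛⁿ′).**  (R1) = clean Phase II of reach-tidy and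
(R3ᵛⁿ′) = the clean curve slice for curves needing an insertion or carrying a very near point, both verbatim from ✓ `cleanProp44_of_tauOneResidualVN3`;
**(R2ˡⁱⁿᵉ) = the clean `τ = 1` isolated-point slice asked ONLY at points whose blowing up carries a NEAR LINE** (a non-closed point `η'` over `x`
with `ord_{η'} J₁ = m`).  Proof: the points-only descent `exists_isCleanPermissibleSeq_lt_comap_of_isolated_tauOne_of_nearLine` supplies (R2) (hence
(R2ᵛⁿ′)) from (R2ˡⁱⁿᵉ), and ✓ `cleanProp44_of_tauOneResidualVN3` concludes. [cite: CossartPiltant2008, Prop. 4.4, Lemma 4.5]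
[cite: CossartJannsenSaito2020, Thm. 13.7] [cite: Piltant2013, Prop. 5.1 (proof, Step 2)] -/
theorem cleanProp44_of_tauOneResidualLine
    (hphaseTwo : ∀ (p : ℕ), p.Prime → ∀ {X : Scheme.{0}} [IsIntegral X] [IsNoetherian X], CharP X.functionField p →
      ∀ (hX : Scheme.IsRegular X), Scheme.IsQuasiExcellent X → topologicalKrullDim X ≤ 3 →
      ∀ (G : X.functionField), (∀ x : X, CleanRegAt p (algebraMap (X.presheaf.stalk x) X.functionField) G) →
      ∀ (J : X.IdealSheafData) {μ : ℕ}, 1 ≤ μ → (∀ z, idealOrder J z ≤ μ) → (∀ z ∈ J.support, 1 < Order.coheight z) →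
      (∀ x : X, ¬ ∃ C ∈ {C : Closeds X | ∃ ζ ∈ maxPoints {z : X | (μ : ℕ∞) ≤ idealOrder J z},
          ¬ IsClosed ({ζ} : Set X) ∧ C = ⟨closure {ζ}, isClosed_closure⟩},
        x ∈ (vanishingIdeal C).subschemeι '' (Scheme.regularLocus (vanishingIdeal C).subscheme)ᶜ ∨
        (x ∈ (C : Set X) ∧ ∃ C' ∈ {C : Closeds X | ∃ ζ ∈ maxPoints {z : X | (μ : ℕ∞) ≤ idealOrder J z},
            ¬ IsClosed ({ζ} : Set X) ∧ C = ⟨closure {ζ}, isClosed_closure⟩}, C' ≠ C ∧ x ∈ (C' : Set X) ∧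
          stalkIdeal (vanishingIdeal C) x ⊔ stalkIdeal (vanishingIdeal C') x ≠ maximalIdeal (X.presheaf.stalk x))) →
      ∃ (X₁ : Scheme.{0}) (Φ : X₁ ⟶ X) (_ : IsIntegral X₁) (_ : IsDominant Φ) (J₁ : X₁.IdealSheafData)
        (_ : IsCleanPermissibleSeq p Φ J μ J₁ G),
        (∀ ζ : X₁, (μ : ℕ∞) ≤ idealOrder J₁ ζ → Order.coheight ζ = 2 → ¬ IsClosed ({ζ} : Set X₁) →
            Scheme.IsRegular (vanishingIdeal (⟨closure {ζ}, isClosed_closure⟩ : Closeds X₁)).subscheme) ∧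
        (∀ ζ₁ ζ₂ : X₁, (μ : ℕ∞) ≤ idealOrder J₁ ζ₁ → Order.coheight ζ₁ = 2 → ¬ IsClosed ({ζ₁} : Set X₁) →
            (μ : ℕ∞) ≤ idealOrder J₁ ζ₂ → Order.coheight ζ₂ = 2 → ¬ IsClosed ({ζ₂} : Set X₁) → ζ₁ ≠ ζ₂ →
            Disjoint (closure ({ζ₁} : Set X₁)) (closure {ζ₂})))
    (htauOneLine : ∀ (p : ℕ), p.Prime → ∀ {X : Scheme.{0}} [IsIntegral X] [IsNoetherian X], CharP X.functionField p →
      ∀ (hX : Scheme.IsRegular X), Scheme.IsQuasiExcellent X → topologicalKrullDim X ≤ 3 →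
      ∀ (G : X.functionField), (∀ x : X, CleanRegAt p (algebraMap (X.presheaf.stalk x) X.functionField) G) →
      ∀ (J : X.IdealSheafData) {m : ℕ}, 1 ≤ m → (∀ z, idealOrder J z ≤ m) → (∀ z ∈ J.support, 1 < Order.coheight z) →
      ∀ (V : X.Opens) (x : X), x ∈ V → ∀ (hcl : IsClosed ({x} : Set X)),
      (∀ z : X, (m : ℕ∞) ≤ idealOrder J z → z = x ∨ z ∉ (V : Set X)) → idealOrder J x = m →
      (maximalIdeal (X.presheaf.stalk x)).spanFinrank = 3 → (haveI := hX x; stalkTau J x m = 1) → IsGRing (X.presheaf.stalk x) →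
      -- (LINE) SOME blowing up of `X` at `x` carries a NEAR LINE: a non-closed point over `x` of order `m`
      (∃ (X₁ : Scheme.{0}) (π : X₁ ⟶ X), IsBlowup π (vanishingIdeal ⟨{x}, hcl⟩) ∧
        ∃ η : X₁, π η = x ∧ idealOrder (controlledTransform π (vanishingIdeal ⟨{x}, hcl⟩) J m) η = m ∧ ¬ IsClosed ({η} : Set X₁)) →
      ∀ [IsIntegral ((V : X.Opens) : Scheme.{0})] [IsDominant V.ι],
      ∃ (V' : Scheme.{0}) (π : V' ⟶ V) (_ : IsIntegral V') (_ : IsDominant π) (K' : V'.IdealSheafData),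
        IsCleanPermissibleSeq p π (J.comap V.ι) m K' (RatFn.functionFieldMap V.ι G) ∧ ∀ y, idealOrder K' y < m)
    (hcurveTauOneVN : ∀ (p : ℕ), p.Prime → ∀ {X : Scheme.{0}} [IsIntegral X] [IsNoetherian X], CharP X.functionField p →
      ∀ (hX : Scheme.IsRegular X), Scheme.IsQuasiExcellent X → topologicalKrullDim X ≤ 3 →
      ∀ (G : X.functionField), (∀ x : X, CleanRegAt p (algebraMap (X.presheaf.stalk x) X.functionField) G) →
      ∀ (J : X.IdealSheafData) {m : ℕ}, 1 ≤ m → (∀ z, idealOrder J z ≤ m) → (∀ z ∈ J.support, 1 < Order.coheight z) →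
      ∀ (V : X.Opens) (Y : Closeds X), Scheme.IsRegular (vanishingIdeal Y).subscheme → IsIrreducible (Y : Set X) →
      (Y : Set X) ⊆ (V : Set X) → (∀ z : X, (m : ℕ∞) ≤ idealOrder J z → z ∈ (Y : Set X) ∨ z ∉ (V : Set X)) →
      (∀ y ∈ (Y : Set X), idealOrder J y = m) →
      (∀ y ∈ (Y : Set X), haveI := hX y; ∃ c : Fin 2 → X.presheaf.stalk y, IsRsopPart c ∧
        Ideal.span (Set.range c) = stalkIdeal (vanishingIdeal Y) y) →
      (¬ ∀ y ∈ (Y : Set X), IsClosed ({y} : Set X) → haveI := hX y; 2 ≤ stalkTau J y m) →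
      -- (VN′) NOT (clean-permissible at every point of `Y` AND no very near point over `Y` for the blowing ups of `X` along `Y`)
      (¬ ((∀ y ∈ (Y : Set X), CleanPermissibleAt p (algebraMap (X.presheaf.stalk y) X.functionField) G (stalkIdeal (vanishingIdeal Y) y)) ∧
          (∀ (X₁ : Scheme.{0}) (π : X₁ ⟶ X), IsBlowup π (vanishingIdeal Y) →
            ∀ x' : X₁, IsClosed ({x'} : Set X₁) → π x' ∈ (Y : Set X) →
              idealOrder (controlledTransform π (vanishingIdeal Y) J m) x' = m →
              (maximalIdeal (X₁.presheaf.stalk x')).spanFinrank = 3 →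
              ∀ hr : IsRegularLocalRing (X₁.presheaf.stalk x'), 2 ≤ @stalkTau X₁ (controlledTransform π (vanishingIdeal Y) J m) x' hr m))) →
      ∀ [IsIntegral ((V : X.Opens) : Scheme.{0})] [IsDominant V.ι],
      ∃ (V' : Scheme.{0}) (π : V' ⟶ V) (_ : IsIntegral V') (_ : IsDominant π) (K' : V'.IdealSheafData),
        IsCleanPermissibleSeq p π (J.comap V.ι) m K' (RatFn.functionFieldMap V.ι G) ∧ ∀ y, idealOrder K' y < m) :
    ∀ (p : ℕ), p.Prime → ∀ (S : Scheme.{0}) [IsIntegral S] [IsNoetherian S],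
      CharP S.functionField p → Scheme.IsRegular S → Scheme.IsExcellent S → topologicalKrullDim S = 3 →
      ∀ G₀ : S.functionField, (∀ s : S, CleanRegAt p (algebraMap (S.presheaf.stalk s) S.functionField) G₀) →
      ∀ I : S.IdealSheafData, I ≠ ⊥ →
      ∀ (X : Scheme.{0}) (ρ : X ⟶ S) [IsIntegral X] [IsNoetherian X] [IsDominant ρ],
        IsCleanRegularCentreBlowupSeq p ρ I G₀ →
        (∀ x : X, CleanRegAt p (algebraMap (X.presheaf.stalk x) X.functionField) (RatFn.functionFieldMap ρ G₀)) →
        ∀ (J : X.IdealSheafData) (μ : ℕ), 1 ≤ μ →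
          (∀ x ∈ J.support, 1 < Order.coheight x) → (∀ x, idealOrder J x ≤ μ) → (∃ x, idealOrder J x = μ) →
          ∃ (X' : Scheme.{0}) (π : X' ⟶ X) (_ : IsIntegral X') (_ : IsDominant π) (J' : X'.IdealSheafData),
            IsCleanPermissibleSeq p π J μ J' (RatFn.functionFieldMap ρ G₀) ∧ ∀ x, idealOrder J' x < μ := by
  refine cleanProp44_of_tauOneResidualVN3 hphaseTwo ?_ hcurveTauOneVN
  intro p hp X _ _ hchar hX hqe hX3 G hG J m hm hle hcodim V x hxV hcl hbad hord hdim hτ hGr _ _ _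
  haveI := hchar
  exact exists_isCleanPermissibleSeq_lt_comap_of_isolated_tauOne_of_nearLine hp hm
    (fun hch hY hYqe hY3 GY hGY JY hleY hcodY W y hyW hycl hbadY hordY hdimY hτY hGrY hl =>
      htauOneLine p hp hch hY hYqe hY3 GY hGY JY hm hleY hcodY W y hyW hycl hbadY hordY hdimY hτY hGrY hl)
    hX hqe hX3 G hG J hle hcodim V x hxV hcl hbad hord hdim hτ hGr

end Summit.ResolutionOfSingularities.ResolutionOfSingularities.Theorems.RadicialJung.CleanModels

end
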